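import Literature.NumberTheory.Automorphic.UnitaryGroupAutomorphicRep     -- ★ `unitaryGroupOfForm`, `mem_unitaryGroupOfForm_iff`
import Mathlib.LinearAlgebra.Matrix.Charpoly.Basic
import Mathlib.Topology.Instances.Matrix
import HarnessLib

/-!
# Rank-two frame algebra for unitary groups: commuting ⇒ diagonal in the frame, `J`-orthogonality of eigenframes, unitarity of frame-diagonal elements, continuity of `GL`-valued diagonals
# (Rogawski 1990 §3.6 p. 31)

Topic `NumberTheory/Rogawski1990`; namespace `Literature.NumberTheory.Rogawski1990`.  THEOREMS ONLY (no definition, no instance, no notation, no named fact, no `sorry`), GENERIC: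
a commutative ring `R` (a domain where stated) with a ring endomorphism `σ`, a form matrix `J ∈ M₂(R)`, a frame `P ∈ GL₂(R)`.  Cell `pub/hodgecm-mathlib`, crux H413 =
`stmt-HodgeConjecture-24833`; the generic half of the S2 «torus-transport `τ`-rider» (LEAD F0P3a-plan (g9) WORD T8-102 (i); consumer = the sibling CM module
`LocalEndoscopicTorusTransportCM`).
* `eq_diagonal_of_mul_diagonal_comm` (commuting with `diag(d)`, `d₀ ≠ d₁` ⇒ diagonal), `mul_frame_eq_frame_mul_diagonal_of_commute` (commuting with `P diag(d) P⁻¹` ⇒ `B P = P diag`),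
  `gram_conj_diagonal` ∕ `gram_offDiag_eq_zero` ∕ `norm_diag_eq_one_of_gram` (the Gram matrix `σ(P)ᵀ J P` of an eigenframe of a unitary: `σ(D) G D = G`, off-diagonal zero, norm-one
  eigenvalues), `conj_diagonal_mem_unitaryGroupOfForm_of_gram` (`P diag(e) P⁻¹ ∈ U(σ, J)` for norm-one `e`), `charpoly_eq_of_mul_frame_eq`, `charpoly_frame_mul_diagonal_mul`,
  `val_inv_mk''_diagonal_two` ∕ `val_inv_mk''_smul_one`, `continuous_mk''_diagonal_two` ∕ `continuous_mk''_smul_one`.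
HONEST SCOPE.  Linear algebra; HC_CM is proved only modulo the printed citations until rung 0 closes.

## References
* J. D. Rogawski, *Automorphic Representations of Unitary Groups in Three Variables*, Ann. of Math. Stud. 123 (1990), §3.6 p. 31. [Rogawski1990]
-/

set_option autoImplicit false

noncomputable section

open Matrix Polynomial Topology Filter
open scoped MatrixGroups

namespace Literature.NumberTheory.Rogawski1990

open Literature.NumberTheory.Automorphic

/-! ## §1 Generic `2 × 2` frame algebra -/

section Frame

variable {R : Type*} [CommRing R]

/-- A `2 × 2` matrix commuting with `diag(d₀, d₁)`, `d₀ ≠ d₁`, over a domain is diagonal. [cite: Rogawski1990, §3.6 p. 31] -/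
theorem eq_diagonal_of_mul_diagonal_comm [IsDomain R] {d : Fin 2 → R} (hd : d 0 ≠ d 1) (D : Matrix (Fin 2) (Fin 2) R)
    (h : D * diagonal d = diagonal d * D) : D = diagonal ![D 0 0, D 1 1] := by
  have h01 := congrFun (congrFun h 0) 1
  have h10 := congrFun (congrFun h 1) 0
  simp only [mul_diagonal, diagonal_mul] at h01 h10
  have e01 : D 0 1 = 0 := by
    have : D 0 1 * (d 1 - d 0) = 0 := by rw [mul_sub, h01]; ring
    rcases mul_eq_zero.1 this with h | h
    · exact h
    · exact absurd (sub_eq_zero.1 h).symm hd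
  have e10 : D 1 0 = 0 := by
    have : D 1 0 * (d 0 - d 1) = 0 := by rw [mul_sub, h10]; ring
    rcases mul_eq_zero.1 this with h | h
    · exact h
    · exact absurd (sub_eq_zero.1 h) hd
  ext i j
  fin_cases i <;> fin_cases j
  · simp
  · simpa using e01
  · simpa using e10
  · simp

variable (σ : R →+* R) (J : Matrix (Fin 2) (Fin 2) R)

/-- **The Gram identity of a frame**: if `B ∈ U(σ, J)` (`σ(B)ᵀ J B = J`) and `B P = P diag(e)`, then `σ(diag e)ᵀ G diag(e) = G` for `G := σ(P)ᵀ J P`. [cite: Rogawski1990, §3.6 p. 31] -/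
theorem gram_conj_diagonal {B P : Matrix (Fin 2) (Fin 2) R} {e : Fin 2 → R} (hB : (B.map σ)ᵀ * J * B = J) (hP : B * P = P * diagonal e) :
    (diagonal (σ ∘ e)) * ((P.map σ)ᵀ * J * P) * diagonal e = (P.map σ)ᵀ * J * P := by
  have h1 : ((B * P).map σ)ᵀ * J * (B * P) = (P.map σ)ᵀ * J * P := by
    rw [Matrix.map_mul, transpose_mul]
    calc (P.map σ)ᵀ * (B.map σ)ᵀ * J * (B * P) = (P.map σ)ᵀ * ((B.map σ)ᵀ * J * B) * P := by simp only [Matrix.mul_assoc]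
      _ = (P.map σ)ᵀ * J * P := by rw [hB]
  rw [hP, Matrix.map_mul, transpose_mul, diagonal_map (map_zero σ), diagonal_transpose] at h1
  calc diagonal (σ ∘ e) * ((P.map σ)ᵀ * J * P) * diagonal e = diagonal (fun i => σ (e i)) * (P.map σ)ᵀ * J * (P * diagonal e) := by
        simp only [Matrix.mul_assoc]; rfl
    _ = (P.map σ)ᵀ * J * P := h1

/-- Entries of `σ(diag e)ᵀ G diag(e)`: `(i, j) ↦ σ(eᵢ) G_{ij} eⱼ`. [cite: Rogawski1990, §3.6 p. 31] -/
theorem diagonal_mul_mul_diagonal_apply (G : Matrix (Fin 2) (Fin 2) R) (f e : Fin 2 → R) (i j : Fin 2) :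
    (diagonal f * G * diagonal e) i j = f i * G i j * e j := by
  rw [mul_diagonal, diagonal_mul]

/-- **Eigenvectors with `σ(eᵢ)·eⱼ ≠ 1` are `J`-orthogonal**: the off-diagonal Gram entries vanish (domain). [cite: Rogawski1990, §3.6 p. 31] -/
theorem gram_offDiag_eq_zero [IsDomain R] {B P : Matrix (Fin 2) (Fin 2) R} {e : Fin 2 → R} (hB : (B.map σ)ᵀ * J * B = J) (hP : B * P = P * diagonal e)
    (h01 : σ (e 0) * e 1 ≠ 1) (h10 : σ (e 1) * e 0 ≠ 1) :
    ((P.map σ)ᵀ * J * P) 0 1 = 0 ∧ ((P.map σ)ᵀ * J * P) 1 0 = 0 := by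
  have hG := gram_conj_diagonal σ J hB hP
  have g01 := congrFun (congrFun hG 0) 1
  have g10 := congrFun (congrFun hG 1) 0
  rw [diagonal_mul_mul_diagonal_apply] at g01 g10
  simp only [Function.comp_apply] at g01 g10
  constructor
  · have : (σ (e 0) * e 1 - 1) * ((P.map σ)ᵀ * J * P) 0 1 = 0 := by rw [sub_mul, one_mul, sub_eq_zero]; calc _ = σ (e 0) * ((P.map σ)ᵀ * J * P) 0 1 * e 1 := by ring
      _ = _ := g01
    rcases mul_eq_zero.1 this with h | h
    · exact absurd (sub_eq_zero.1 h) h01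
    · exact h
  · have : (σ (e 1) * e 0 - 1) * ((P.map σ)ᵀ * J * P) 1 0 = 0 := by rw [sub_mul, one_mul, sub_eq_zero]; calc _ = σ (e 1) * ((P.map σ)ᵀ * J * P) 1 0 * e 0 := by ring
      _ = _ := g10
    rcases mul_eq_zero.1 this with h | h
    · exact absurd (sub_eq_zero.1 h) h10
    · exact h

/-- **Eigenvalues of a unitary on a non-degenerate orthogonal frame are norm one**: `σ(eᵢ)·eᵢ = 1` when the Gram matrix is diagonal with non-zero diagonal (domain).
[cite: Rogawski1990, §3.6 p. 31] -/
theorem norm_diag_eq_one_of_gram [IsDomain R] {B P : Matrix (Fin 2) (Fin 2) R} {e : Fin 2 → R} (hB : (B.map σ)ᵀ * J * B = J) (hP : B * P = P * diagonal e)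
    (i : Fin 2) (hGi : ((P.map σ)ᵀ * J * P) i i ≠ 0) : σ (e i) * e i = 1 := by
  have hG := gram_conj_diagonal σ J hB hP
  have gi := congrFun (congrFun hG i) i
  rw [diagonal_mul_mul_diagonal_apply] at gi
  simp only [Function.comp_apply] at gi
  have : (σ (e i) * e i - 1) * ((P.map σ)ᵀ * J * P) i i = 0 := by
    rw [sub_mul, one_mul, sub_eq_zero]
    calc _ = σ (e i) * ((P.map σ)ᵀ * J * P) i i * e i := by ring
      _ = _ := gi
  rcases mul_eq_zero.1 this with h | h
  · exact sub_eq_zero.1 h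
  · exact absurd h hGi

/-- **`P·diag(e)·P⁻¹ ∈ U(σ, J)` for norm-one `e` when the frame's Gram matrix is diagonal** (`P ∈ GL₂(R)`). [cite: Rogawski1990, §3.6 p. 31] -/
theorem conj_diagonal_mem_unitaryGroupOfForm_of_gram (P : GL (Fin 2) R) (hG01 : ((P.val.map σ)ᵀ * J * P.val) 0 1 = 0) (hG10 : ((P.val.map σ)ᵀ * J * P.val) 1 0 = 0)
    (e : Fin 2 → R) (he : ∀ i, σ (e i) * e i = 1) (heu : IsUnit (diagonal e).det) :
    P * Matrix.GeneralLinearGroup.mk'' (diagonal e) heu * P⁻¹ ∈ unitaryGroupOfForm σ J := by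
  rw [mem_unitaryGroupOfForm_iff]
  have hval : (((P * Matrix.GeneralLinearGroup.mk'' (diagonal e) heu * P⁻¹ : GL (Fin 2) R)) : Matrix (Fin 2) (Fin 2) R) = P.val * diagonal e * P⁻¹.val := rfl
  rw [hval]
  -- `σ(diag e)ᵀ G diag(e) = G`
  have hGe : diagonal (σ ∘ e) * ((P.val.map σ)ᵀ * J * P.val) * diagonal e = (P.val.map σ)ᵀ * J * P.val := by
    ext i j
    rw [diagonal_mul_mul_diagonal_apply]
    fin_cases i <;> fin_cases j
    · show σ (e 0) * _ * e 0 = _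
      rw [mul_comm (σ (e 0)), mul_assoc, he 0, mul_one]
    · show σ (e 0) * ((P.val.map σ)ᵀ * J * P.val) 0 1 * e 1 = ((P.val.map σ)ᵀ * J * P.val) 0 1
      rw [hG01, mul_zero, zero_mul]
    · show σ (e 1) * ((P.val.map σ)ᵀ * J * P.val) 1 0 * e 0 = ((P.val.map σ)ᵀ * J * P.val) 1 0
      rw [hG10, mul_zero, zero_mul]
    · show σ (e 1) * _ * e 1 = _
      rw [mul_comm (σ (e 1)), mul_assoc, he 1, mul_one]
  -- `σ(P⁻¹) σ(P) = 1`
  have hPinv : (P⁻¹.val.map σ) * (P.val.map σ) = 1 := by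
    rw [← Matrix.map_mul, ← Units.val_mul, inv_mul_cancel, Units.val_one, Matrix.map_one σ (map_zero σ) (map_one σ)]
  have hPinv' : P.val * P⁻¹.val = 1 := by rw [← Units.val_mul, mul_inv_cancel, Units.val_one]
  rw [Matrix.map_mul, Matrix.map_mul, transpose_mul, transpose_mul, diagonal_map (map_zero σ), diagonal_transpose]
  calc _ = (P⁻¹.val.map σ)ᵀ * (diagonal (σ ∘ e) * ((P.val.map σ)ᵀ * J * P.val) * diagonal e) * P⁻¹.val := by
          simp only [Matrix.mul_assoc]; rfl
    _ = (P⁻¹.val.map σ)ᵀ * ((P.val.map σ)ᵀ * J * P.val) * P⁻¹.val := by rw [hGe]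
    _ = ((P.val.map σ) * (P⁻¹.val.map σ))ᵀ * J * (P.val * P⁻¹.val) := by rw [transpose_mul]; simp only [Matrix.mul_assoc]
    _ = J := by
          rw [← Matrix.map_mul, hPinv', Matrix.map_one σ (map_zero σ) (map_one σ), transpose_one, Matrix.one_mul, Matrix.mul_one]

/-- **A matrix commuting with a regular semisimple `A = P·diag(d)·P⁻¹` (`d₀ ≠ d₁`) is diagonal in the same frame**: `B P = P·diag((P⁻¹BP)₀₀, (P⁻¹BP)₁₁)` (domain).
[cite: Rogawski1990, §3.6 p. 31] -/
theorem mul_frame_eq_frame_mul_diagonal_of_commute [IsDomain R] {A : Matrix (Fin 2) (Fin 2) R} (P : GL (Fin 2) R) {d : Fin 2 → R} (hA : A * P.val = P.val * diagonal d)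
    (hd : d 0 ≠ d 1) {B : Matrix (Fin 2) (Fin 2) R} (hBA : B * A = A * B) :
    B * P.val = P.val * diagonal ![(P⁻¹.val * B * P.val) 0 0, (P⁻¹.val * B * P.val) 1 1] := by
  have hPP : P⁻¹.val * P.val = 1 := by rw [← Units.val_mul, inv_mul_cancel, Units.val_one]
  have hPP' : P.val * P⁻¹.val = 1 := by rw [← Units.val_mul, mul_inv_cancel, Units.val_one]
  -- `P⁻¹ A = diag(d) P⁻¹`
  have hA' : P⁻¹.val * A = diagonal d * P⁻¹.val := by
    calc P⁻¹.val * A = P⁻¹.val * A * (P.val * P⁻¹.val) := by rw [hPP', Matrix.mul_one]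
      _ = P⁻¹.val * (A * P.val) * P⁻¹.val := by simp only [Matrix.mul_assoc]
      _ = P⁻¹.val * P.val * diagonal d * P⁻¹.val := by rw [hA]; simp only [Matrix.mul_assoc]
      _ = diagonal d * P⁻¹.val := by rw [hPP, Matrix.one_mul]
  have hD : (P⁻¹.val * B * P.val) * diagonal d = diagonal d * (P⁻¹.val * B * P.val) := by
    calc P⁻¹.val * B * P.val * diagonal d = P⁻¹.val * B * (A * P.val) := by rw [hA]; simp only [Matrix.mul_assoc]
      _ = P⁻¹.val * (B * A) * P.val := by simp only [Matrix.mul_assoc]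
      _ = P⁻¹.val * A * B * P.val := by rw [hBA]; simp only [Matrix.mul_assoc]
      _ = diagonal d * (P⁻¹.val * B * P.val) := by rw [hA']; simp only [Matrix.mul_assoc]
  have hdiag := eq_diagonal_of_mul_diagonal_comm hd _ hD
  calc B * P.val = P.val * (P⁻¹.val * B * P.val) := by
        calc B * P.val = (P.val * P⁻¹.val) * B * P.val := by rw [hPP', Matrix.one_mul]
          _ = _ := by simp only [Matrix.mul_assoc]
    _ = _ := by rw [← hdiag]

/-- `B.charpoly = (X − a)(X − b)` when `B P = P diag(a, b)` for an invertible frame `P`. [cite: Rogawski1990, §3.6 p. 31] -/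
theorem charpoly_eq_of_mul_frame_eq (P : GL (Fin 2) R) {B : Matrix (Fin 2) (Fin 2) R} {a b : R} (h : B * P.val = P.val * diagonal ![a, b]) :
    B.charpoly = (X - C a) * (X - C b) := by
  have hPP : P⁻¹.val * P.val = 1 := by rw [← Units.val_mul, inv_mul_cancel, Units.val_one]
  have hD : P⁻¹.val * B * P.val = diagonal ![a, b] := by
    rw [Matrix.mul_assoc, h, ← Matrix.mul_assoc, hPP, Matrix.one_mul]
  have h2 : (P⁻¹.val * B * P.val).charpoly = B.charpoly := by
    rw [Matrix.coe_units_inv]; exact Matrix.charpoly_units_conj' P B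
  rw [← h2, hD, charpoly_diagonal, Fin.prod_univ_two]
  simp only [Matrix.cons_val_zero, Matrix.cons_val_one]

/-- `(P diag(a, b) P⁻¹).charpoly = (X − a)(X − b)`. [cite: Rogawski1990, §3.6 p. 31] -/
theorem charpoly_frame_mul_diagonal_mul (P : GL (Fin 2) R) (a b : R) :
    (P.val * diagonal ![a, b] * P⁻¹.val).charpoly = (X - C a) * (X - C b) := by
  rw [Matrix.coe_units_inv, Matrix.charpoly_units_conj, charpoly_diagonal, Fin.prod_univ_two]
  simp only [Matrix.cons_val_zero, Matrix.cons_val_one]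

/-- The inverse of `diag(a, b)` with `a a′ = 1 = b b′` is `diag(a′, b′)` (as the `GL` inverse of `mk''`). [cite: Rogawski1990, §3.6 p. 31] -/
theorem val_inv_mk''_diagonal_two {a b a' b' : R} (ha : a * a' = 1) (hb : b * b' = 1) (h : IsUnit (diagonal ![a, b]).det) :
    ((Matrix.GeneralLinearGroup.mk'' (diagonal ![a, b]) h)⁻¹).val = diagonal ![a', b'] := by
  apply Units.inv_eq_of_mul_eq_one_right
  change diagonal ![a, b] * diagonal ![a', b'] = 1
  rw [diagonal_mul_diagonal, ← diagonal_one]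
  congr 1
  funext i; fin_cases i
  · simpa using ha
  · simpa using hb

/-- The inverse of the `1 × 1` scalar `a • 1` with `a a′ = 1` is `a′ • 1`. [cite: Rogawski1990, §3.6 p. 31] -/
theorem val_inv_mk''_smul_one {a a' : R} (ha : a * a' = 1) (h : IsUnit (a • (1 : Matrix (Fin 1) (Fin 1) R)).det) :
    ((Matrix.GeneralLinearGroup.mk'' (a • (1 : Matrix (Fin 1) (Fin 1) R)) h)⁻¹).val = a' • (1 : Matrix (Fin 1) (Fin 1) R) := by
  apply Units.inv_eq_of_mul_eq_one_right
  change a • (1 : Matrix (Fin 1) (Fin 1) R) * (a' • 1) = 1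
  rw [smul_mul_smul_comm, Matrix.mul_one, ha, one_smul]

/-- **Continuity of `x ↦ diag(f x, g x) ∈ GL₂(R)`** for continuous `f, g` with continuous explicit inverses `f′, g′`. [cite: Rogawski1990, §3.6 p. 31] -/
theorem continuous_mk''_diagonal_two [TopologicalSpace R] [IsTopologicalRing R] {X : Type*} [TopologicalSpace X] {f g f' g' : X → R}
    (hf : Continuous f) (hg : Continuous g) (hf' : Continuous f') (hg' : Continuous g') (hff : ∀ x, f x * f' x = 1) (hgg : ∀ x, g x * g' x = 1)
    (h : ∀ x, IsUnit (diagonal ![f x, g x]).det) :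
    Continuous fun x => Matrix.GeneralLinearGroup.mk'' (diagonal ![f x, g x]) (h x) := by
  refine Units.continuous_iff.2 ⟨?_, ?_⟩
  · have hc : Continuous fun x => diagonal ![f x, g x] := by
      refine Continuous.matrix_diagonal (continuous_pi fun i => ?_)
      fin_cases i
      · exact hf
      · exact hg
    exact hc
  · have heq : (fun x => ((Matrix.GeneralLinearGroup.mk'' (diagonal ![f x, g x]) (h x))⁻¹).val) = fun x => diagonal ![f' x, g' x] :=
      funext fun x => val_inv_mk''_diagonal_two (hff x) (hgg x) (h x)
    have hc : Continuous fun x => diagonal ![f' x, g' x] := by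
      refine Continuous.matrix_diagonal (continuous_pi fun i => ?_)
      fin_cases i
      · exact hf'
      · exact hg'
    exact (show Continuous fun x => ((Matrix.GeneralLinearGroup.mk'' (diagonal ![f x, g x]) (h x))⁻¹).val from heq ▸ hc)

/-- **Continuity of `x ↦ (f x)·1 ∈ GL₁(R)`** for continuous `f` with a continuous explicit inverse `f′`. [cite: Rogawski1990, §3.6 p. 31] -/
theorem continuous_mk''_smul_one [TopologicalSpace R] [IsTopologicalRing R] {X : Type*} [TopologicalSpace X] {f f' : X → R}
    (hf : Continuous f) (hf' : Continuous f') (hff : ∀ x, f x * f' x = 1) (h : ∀ x, IsUnit (f x • (1 : Matrix (Fin 1) (Fin 1) R)).det) :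
    Continuous fun x => Matrix.GeneralLinearGroup.mk'' (f x • (1 : Matrix (Fin 1) (Fin 1) R)) (h x) := by
  refine Units.continuous_iff.2 ⟨?_, ?_⟩
  · have hc : Continuous fun x => f x • (1 : Matrix (Fin 1) (Fin 1) R) := hf.smul continuous_const
    exact hc
  · have heq : (fun x => ((Matrix.GeneralLinearGroup.mk'' (f x • (1 : Matrix (Fin 1) (Fin 1) R)) (h x))⁻¹).val) = fun x => f' x • (1 : Matrix (Fin 1) (Fin 1) R) :=
      funext fun x => val_inv_mk''_smul_one (hff x) (h x)
    have hc : Continuous fun x => f' x • (1 : Matrix (Fin 1) (Fin 1) R) := hf'.smul continuous_const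
    exact (show Continuous fun x => ((Matrix.GeneralLinearGroup.mk'' (f x • (1 : Matrix (Fin 1) (Fin 1) R)) (h x))⁻¹).val from heq ▸ hc)

end Frame


end Literature.NumberTheory.Rogawski1990

end
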